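import Summits.CriticalPhenomena.CardyFormulaZ2.Theorems.CardyGluingRDEGluingContractionOfRate
import Summits.CriticalPhenomena.CardyFormulaZ2.Theorems.CardyGluingRDEContractionGivesMerging
import HarnessLib.Audit

/-!
# Crux `GluingContraction` (stmt-CriticalPhenomena-8580), line `registered` — RESHAPED skeleton (lead c4-0)

The registered four-stub skeleton of this line (`Lines/birth.lean`, sha 3ca46974…: `stub_shadowingZ`,
`stub_shadowingT`, `stub_psiContraction`, `stub_entry`, glued predictions `Ψ^m` with
`Ψ_k = gluingRDE planarCoinGlue`) is DEAD: `stub_shadowingZ` is formally false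
(`Theorems.StubShadowingZ.stub_shadowingZ_false`, `Theorems/GluingContraction/Negative/`, p152478;
leads c2-0, c3-0; re-verified by c4-0 by direct term application against the registered statement), and
every non-degenerate law-level gluing map on pairwise-matrix states collapses to `δ_{all joined}` on
connected read laws (`Theorems/CardyGluingRDEGluingContractionPsiCollapse.lean`, p147738).

The only instance of the line's composition (triangle inequality
`Dw(ℤ²@u/2^m, 𝕋@u'/2^m) ≤ D(ℤ²@u/2^m, Ψ^m ℤ²@u) + D(Ψ^m ℤ²@u, Ψ^m 𝕋@u') + D(Ψ^m 𝕋@u', 𝕋@u'/2^m)`)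
that survives is the DEGENERATE gluing map `Ψ ≡ π` (the constant map onto a common limit law `π`): the
middle term vanishes (`θ = 0`), and the two shadowing terms become "power-law rate of the `ℤ²` level-`j`
law to `π` from the lattice-resolution onset" (H_Z) and "convergence of the `𝕋` level-`j` law to the same
`π`" (H_T).  For this instance the composition is ALREADY LANDED:
`Theorems.GluingContraction_of_levelRate` (p150075, lead c3-0; `σ = γ + α`, `κ = α`, `θ = 0`, `m = 1`).
So the reshaped skeleton has exactly ONE stub, `stub_rateMerging := H_Z ∧ H_T` (the two halves share the
existential limit `π`, hence one registered statement), and `GluingContraction_of` is one line.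

Status of the stub (see `Lines/registered_dead.md` §c4-0 and `Lines/registered_hypotheses.lean`): it is
crux-sized — it implies the crux, the crux is equivalent to (clause A) ∧ `BoxMerging`
(`Theorems.BoxMerging_gluingContraction_iff`) and implies `BoxMerging` (stmt-CriticalPhenomena-8582, open,
XL: universality of joint segment laws); H_Z is power-law-rate universality for bond-`ℤ²` (no published
proof exists), H_T is Camia–Newman-strength joint-law convergence on site-`𝕋` (not in the tree).  This
file registers that honest residue in place of the refuted four-stub set; it is not a claim that the stub
is attackable.  The only `sorry` is `stub_rateMerging`.
-/

namespace Summit.CriticalPhenomena.CardyFormulaZ2.Cruxes.GluingContraction.RegisteredRate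

open Summit.CriticalPhenomena.CardyFormulaZ2

/-- **STUB (the only one) — rate-merging at every level** (H_Z ∧ H_T, the hypothesis of the landed
`Theorems.GluingContraction_of_levelRate`, route notation inlined verbatim): there are an exponent
`α > 0`, constants `A, γ ≥ 0` and limit vectors `π δ₀ j` such that (H_Z) the bond-`ℤ²` law of the
level-`j` segment-connectivity matrix of the square `(0, δ₀)²` at mesh `u ≤ δ₀` is within
`A·2^(γ j)·(u/δ₀)^α` of `π δ₀ j` in total variation, and (H_T) the site-`𝕋` law of the same matrix
converges to `π δ₀ j` as the mesh `u' → 0⁺`. -/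
theorem stub_rateMerging :
    let PZ := Literature.Probability.Percolation.bondPercolation (Literature.Probability.LatticeModels.zdGraph 2) Literature.Probability.Percolation.half; let PT := Literature.Probability.LatticeModels.triSitePercolation Literature.Probability.Percolation.half; let Sq : ℝ → Set ℂ := fun δ₀ => {z : ℂ | 0 < z.re ∧ z.re < δ₀ ∧ 0 < z.im ∧ z.im < δ₀}; let seg : (δ₀ : ℝ) → (j : ℕ) → Fin 4 × Fin (2 ^ j) → Set ℂ := fun δ₀ j a => {z : ℂ | (a.1 = 0 ∧ z.im = 0 ∧ δ₀ * ((a.2 : ℕ) : ℝ) / 2 ^ j ≤ z.re ∧ z.re ≤ δ₀ * (((a.2 : ℕ) : ℝ) + 1) / 2 ^ j) ∨ (a.1 = 1 ∧ z.re = δ₀ ∧ δ₀ * ((a.2 : ℕ) : ℝ) / 2 ^ j ≤ z.im ∧ z.im ≤ δ₀ * (((a.2 : ℕ) : ℝ) + 1) / 2 ^ j) ∨ (a.1 = 2 ∧ z.im = δ₀ ∧ δ₀ * ((a.2 : ℕ) : ℝ) / 2 ^ j ≤ z.re ∧ z.re ≤ δ₀ * (((a.2 : ℕ) : ℝ) +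 1) / 2 ^ j) ∨ (a.1 = 3 ∧ z.re = 0 ∧ δ₀ * ((a.2 : ℕ) : ℝ) / 2 ^ j ≤ z.im ∧ z.im ≤ δ₀ * (((a.2 : ℕ) : ℝ) + 1) / 2 ^ j)}; let EZ : (δ₀ : ℝ) → (j : ℕ) → ℝ → ((Fin 4 × Fin (2 ^ j)) → (Fin 4 × Fin (2 ^ j)) → Bool) → Set (Literature.Probability.Percolation.BondConfig (Literature.Probability.LatticeModels.Site 2)) := fun δ₀ j u M => {ω | ∀ a b, ω ∈ Literature.Probability.Percolation.discreteCrossing (Sq δ₀) u (seg δ₀ j a) (seg δ₀ j b) ↔ M a b = true}; let ET : (δ₀ : ℝ) → (j : ℕ) → ℝ → ((Fin 4 × Fin (2 ^ j)) → (Fin 4 × Fin (2 ^ j)) → Bool) → Set (Literature.Probability.Percolation.SiteConfig (Literature.Probability.LatticeModels.Site 2)) := fun δ₀ j u M => {ω | ∀ a b, ω ∈ Literature.Probability.LatticeModels.triCrossing (Sq δ₀) u (seg δ₀ j a) (seg δ₀ j b) ↔ M a b = true}; ∃ α A γ : ℝ, 0 < α ∧ 0 ≤ A ∧ 0 ≤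 γ ∧ ∃ π : (δ₀ : ℝ) → (j : ℕ) → ((Fin 4 × Fin (2 ^ j)) → (Fin 4 × Fin (2 ^ j)) → Bool) → ℝ, (∀ δ₀ : ℝ, 0 < δ₀ → ∀ (j : ℕ) (u : ℝ), 0 < u → u ≤ δ₀ → (1 / 2 : ℝ) * ∑ M : (Fin 4 × Fin (2 ^ j)) → (Fin 4 × Fin (2 ^ j)) → Bool, |PZ.real (EZ δ₀ j u M) - π δ₀ j M| ≤ A * (2 : ℝ) ^ (γ * (j : ℝ)) * (u / δ₀) ^ α) ∧ (∀ δ₀ : ℝ, 0 < δ₀ → ∀ (j : ℕ) (ε : ℝ), 0 < ε → ∃ δT : ℝ, 0 < δT ∧ ∀ u' : ℝ, 0 < u' → u' ≤ δT → (1 / 2 : ℝ) * ∑ M : (Fin 4 × Fin (2 ^ j)) → (Fin 4 × Fin (2 ^ j)) → Bool, |PT.real (ET δ₀ j u' M) - π δ₀ j M| ≤ ε) := by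
  sorry

/-! ### The stub STATEMENT under its own short name (hypothesis of `GluingContraction_of`) -/

namespace Statement

/-- Statement of the only stub (`H_Z ∧ H_T`). -/
abbrev stub_rateMerging : Prop :=
  type_of% Summit.CriticalPhenomena.CardyFormulaZ2.Cruxes.GluingContraction.RegisteredRate.stub_rateMerging

end Statement

/-! ### Assembly: the stub gives the crux (no `sorry` below this line) -/

/-- **The crux from the stub**: `GluingContraction_of : stub_rateMerging → GluingContraction`, one line
over the landed composition `Theorems.GluingContraction_of_levelRate` (p150075: common onset, geometric
level sum, `θ = 0`, `m = 1`). -/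
theorem GluingContraction_of (h : Statement.stub_rateMerging) :
    Theses.CardyGluingRDE.GluingContraction :=
  Theorems.GluingContraction_of_levelRate h

/-- For the record: the stub also gives the support item `BoxMerging` (stmt-CriticalPhenomena-8582),
through the crux and the landed `Theorems.ContractionGivesMerging_proof` — i.e. `BoxMerging` is
NECESSARY for this stub (and for the crux). -/
theorem boxMerging_of_stub (h : Statement.stub_rateMerging) : Theses.CardyGluingRDE.BoxMerging :=
  Theorems.ContractionGivesMerging_proof (GluingContraction_of h)

end Summit.CriticalPhenomena.CardyFormulaZ2.Cruxes.GluingContraction.RegisteredRate
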